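import Summits.QuantumFields.YangMills.Theses.LangevinControlUV
import Summits.QuantumFields.YangMills.Theses.OneCertifiedCube

/-!
# Crux `LatticeGapInUVUnits`, line `one-ruler`: the checked reduction R1 to femto TV windows

Support file for item stmt-QuantumFields-9366 (route `LangevinControlUV` of `YangMills`; line `one-ruler`, lead c2).
It lands the line's kernel-checkable reduction R1, stated with every hypothesis WRITTEN OUT in the route's own
vocabulary (no definition is introduced):

* `stub_windowReduction` : the finite-size criterion of route `OneCertifiedCube` (item stmt-QuantumFields-8895, BY
  NAME: `Summit.QuantumFields.YangMills.Theses.OneCertifiedCube.FiniteSizeCriterion`) together with FEMTO TV WINDOWS in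
  the units of every continuous package ruler (for every compact simple `G`, faithful `r` and CONTINUOUS unit map `a`
  carrying the femto two-point package: one `(Θ₀, n, ε, β₁)` with the universal threshold `ε · ((4n+3)⁴ − (4n+1)⁴) < 1`
  such that for all `β ≥ β₁` and every cell size `b ≥ Θ₀ / a(β)` the TV finite-size window of the Wilson specification
  `ymSpecification r.ρ β` holds — verbatim the hypothesis block of `FiniteSizeCriterion`) imply the REPAIRED crux C′
  (the crux `LatticeGapInUVUnits` restricted to continuous unit maps): volume-uniform exponential clustering of all
  pairs of gauge-invariant local observables at rate `c₁ · a(β)` per lattice step on the tori `(2S+1)⁴`, `S ≥ S₁ β`.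

The proof is the line's constant-slack bookkeeping (`reduction_concl_of_window`): the criterion hands a universal rate
`κ(n, ε) > 0` and per-pair constants `C(A, B)` with clustering at rate `κ t / b` on every torus `2S+1 ≥ (8n+7) b`
whenever the window holds at cell size `b ≥ 1`; the windows hold at the femto cell `b(β) = ⌈Θ₀ / a(β)⌉ ≥ 1`; and
`a β ≤ Θ₀` eventually (THIS is where the package clause `Tendsto a atTop (𝓝 0)` is load-bearing) gives
`a(β) · b(β) ≤ 2Θ₀`, hence `κ t / b(β) ≥ (κ/(2Θ₀)) · a(β) · t`: clustering with `c₁ = κ/(2Θ₀)`, `β₂ = max β₁ β_Θ`,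
`S₁(β) = (8n+7) ⌈Θ₀ / a(β)⌉` and `C(A, B) = max C 0` — independent of `β, S, t`.
-/

open scoped BigOperators
open MeasureTheory Filter Topology
open Literature.MathematicalPhysics.QuantumFieldTheory Literature.MathematicalPhysics.QuantumLattice
open Summit.QuantumFields.YangMills.Theses

noncomputable section

namespace Summit.QuantumFields.YangMills.Theorems.LatticeGapInUVUnits.OneRuler

section Pipeline

variable {G : Type} [Group G] [TopologicalSpace G] [IsTopologicalGroup G] [CompactSpace G]
  [MeasurableSpace G] [BorelSpace G]

/-- **The pipeline (finite-size criterion + femto TV windows ⇒ clustering in the units of `a`)**, the line's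
constant-slack bookkeeping: if the finite-size criterion holds and the positive unit map `a → 0` has, for all
`β ≥ β₁`, the TV window (cube radius `n`, threshold `ε`, `ε · ((4n+3)⁴ − (4n+1)⁴) < 1`, `n ≥ 1`) at every cell size
`b ≥ Θ / a(β)`, then all pairs cluster at rate `(κ/(2Θ)) · a(β)` on every torus `2S+1` with
`S ≥ S₁(β) := (8n+7) ⌈Θ / a(β)⌉`, `β ≥ max β₁ β_Θ` (`a ≤ Θ` beyond `β_Θ`, so that `a · ⌈Θ/a⌉ ≤ 2Θ`), with the
criterion's per-pair constants `C(A, B) = max C 0` — independent of `β, S, n`. -/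
theorem reduction_concl_of_window
    (hF : Summit.QuantumFields.YangMills.Theses.OneCertifiedCube.FiniteSizeCriterion)
    (r : LatticeRep G) {a : ℝ → ℝ} (hpos : ∀ β, 0 < a β) (hlim : Tendsto a atTop (𝓝 0))
    {Θ : ℝ} {n : ℕ} {ε β₁ : ℝ} (hΘ : 0 < Θ) (hn : 1 ≤ n) (hε : 0 ≤ ε)
    (hεM : ε * ((((4 * n + 3) ^ 4 - (4 * n + 1) ^ 4 : ℕ)) : ℝ) < 1)
    (hwin : ∀ β : ℝ, β₁ ≤ β → ∀ b : ℕ, Θ / a β ≤ (b : ℝ) → ∀ w : Fin 4 → ℤ → ℤ, (∀ i j, w i j + ((b : ℕ) : ℤ) ≤ w i (j + 1) ∧ w i (j + 1) ≤ w i j + 2 * ((b : ℕ) : ℤ)) → ∀ Y : Finset (Fin 4 → ℤ), Y ⊆ (Fintype.piFinset fun _ : Fin 4 => Finset.Icc (-(2 * ((n : ℕ) : ℤ))) (2 * ((n : ℕ) : ℤ))) → (0 : Fin 4 → ℤ) ∈ Y → ∀ η η' : LGConfig 4 G, (∀ e ∈ (Fintype.piFinset fun _ : Fin 4 => Finset.Icc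 (-(2 * ((n : ℕ) : ℤ))) (2 * ((n : ℕ) : ℤ))).biUnion (fun y : Fin 4 → ℤ => (Fintype.piFinset fun i : Fin 4 => Finset.Ico (w i (y i)) (w i (y i + 1))) ×ˢ (Finset.univ : Finset (Fin 4))), η e = η' e) → ∀ f : LGConfig 4 G → ℝ, IsCylinder f ((fun y : Fin 4 → ℤ => (Fintype.piFinset fun i : Fin 4 => Finset.Ico (w i (y i)) (w i (y i + 1))) ×ˢ (Finset.univ : Finset (Fin 4))) 0) → Measurable f → (∀ U, 0 ≤ f U ∧ f U ≤ 1) → |(∫ U, f U ∂(ymSpecification r.ρ β (Y.biUnion (fun y : Fin 4 → ℤ => (Fintype.piFinset fun i : Fin 4 => Finset.Ico (w i (y i)) (w i (y i + 1))) ×ˢ (Finset.univ : Finset (Fin 4)))) η)) - ∫ U, f U ∂(ymSpecification r.ρ β (Y.biUnion (fun y : Fin 4 → ℤ => (Fintype.piFinset fun i : Fin 4 => Finset.Ico (w i (y i)) (w i (y i + 1))) ×ˢ (Finset.univ : Finset (Fin 4)))) η')| ≤ ε) :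
    ∃ (c₁ β₂ : ℝ) (S₁ : ℝ → ℕ), 0 < c₁ ∧ ∀ A B : YMSpecies G, ∃ C : ℝ, ∀ β : ℝ, β₂ ≤ β → ∀ S n : ℕ, S₁ β ≤ S → n ≤ S → |latticeConnectedCorr r.ρ β (2 * S + 1) A.F B.F n| ≤ C * Real.exp (-(c₁ * a β * n)) := by
  -- the universal rate `κ(n, ε)` and the per-pair constants of the finite-size criterion
  obtain ⟨κ, hκ, H⟩ := hF n ε hn hε hεM
  -- `a β ≤ Θ` eventually (`Tendsto a atTop (𝓝 0)` is load-bearing exactly here)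
  obtain ⟨βΘ, hβΘ⟩ := Filter.eventually_atTop.1 (hlim (Iic_mem_nhds hΘ))
  refine ⟨κ / (2 * Θ), max β₁ βΘ, fun β => (8 * n + 7) * ⌈Θ / a β⌉₊, div_pos hκ (by positivity),
    fun A B => ?_⟩
  obtain ⟨C, hC⟩ := H G r.N r.ρ r.continuous r.injective A B
  refine ⟨max C 0, fun β hβ S t hS ht => ?_⟩
  have hβ₁ : β₁ ≤ β := le_of_max_le_left hβ
  have haΘ : a β ≤ Θ := hβΘ β (le_of_max_le_right hβ)
  have hapos : 0 < a β := hpos β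
  -- the femto cell `b = ⌈Θ / a β⌉ ≥ 1`, with `a β · b ≤ 2Θ`
  set b : ℕ := ⌈Θ / a β⌉₊ with hbdef
  have hbpos : 0 < b := Nat.ceil_pos.2 (div_pos hΘ hapos)
  have hb1 : 1 ≤ b := hbpos
  have hbR : (0 : ℝ) < (b : ℝ) := by exact_mod_cast hbpos
  have hbge : Θ / a β ≤ (b : ℝ) := Nat.le_ceil _
  have hbub : (b : ℝ) < Θ / a β + 1 := Nat.ceil_lt_add_one (div_pos hΘ hapos).le
  have hab : a β * (b : ℝ) ≤ 2 * Θ := by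
    have h1 : a β * (b : ℝ) ≤ a β * (Θ / a β + 1) := mul_le_mul_of_nonneg_left hbub.le hapos.le
    have h2 : a β * (Θ / a β + 1) = Θ + a β := by field_simp
    linarith
  have hS' : (8 * n + 7) * b ≤ 2 * S + 1 := by
    have : (8 * n + 7) * b ≤ S := hS
    omega
  -- the criterion at cell size `b`, fed with the femto window at `b`
  have key := hC β b hb1 (hwin β hβ₁ b hbge) S hS' t ht
  refine key.trans ?_
  -- compare the exponents: `κ/(2Θ) · a β · t ≤ κ t / b` because `a β · b ≤ 2Θ`
  have ht0 : (0 : ℝ) ≤ (t : ℝ) := Nat.cast_nonneg t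
  have hrate : κ / (2 * Θ) * a β * t ≤ κ * t / b := by
    have hq : a β / (2 * Θ) ≤ 1 / (b : ℝ) := by
      rw [div_le_div_iff₀ (by positivity) hbR]
      linarith
    have hmul := mul_le_mul_of_nonneg_left hq (mul_nonneg hκ.le ht0)
    have e1 : κ / (2 * Θ) * a β * t = κ * t * (a β / (2 * Θ)) := by ring
    have e2 : κ * t / b = κ * t * (1 / (b : ℝ)) := by ring
    rw [e1, e2]
    exact hmul
  calc C * Real.exp (-(κ * t / b)) ≤ max C 0 * Real.exp (-(κ * t / b)) :=
        mul_le_mul_of_nonneg_right (le_max_left _ _) (Real.exp_pos _).le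
    _ ≤ max C 0 * Real.exp (-(κ / (2 * Θ) * a β * t)) :=
        mul_le_mul_of_nonneg_left (Real.exp_le_exp.2 (neg_le_neg hrate)) (le_max_right _ _)

end Pipeline

/-- **R1 — the line's registered reduction stub, def-free with minimal hypotheses** (line `one-ruler` of item
stmt-QuantumFields-9366, registered signature): the finite-size criterion (item stmt-QuantumFields-8895 BY NAME) and
femto TV windows from `Θ₀ / a(β)` on (one `(n, ε)` with `ε · ((4n+3)⁴ − (4n+1)⁴) < 1`, all `β ≥ β₁`) imply, for every
positive unit map `a → 0` (no package, no continuity and no simplicity are needed by the bookkeeping), volume-uniform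
exponential clustering of all pairs of gauge-invariant local observables at rate `c₁ · a(β)` per lattice step —
`c₁ = κ/(2Θ₀)`, `S₁(β) = (8n+7) ⌈Θ₀ / a(β)⌉`, per-pair constants `max C(A, B) 0` (`reduction_concl_of_window`). With the
physics stub of the line (femto windows for every continuous package ruler) this is the repaired crux C′; with the
socket `RulerReduction` on top, the crux `LatticeGapInUVUnits` by name
(`FemtoSlabNondegeneracy.latticeGapInUVUnits_of_rulerReduction_of_cruxRepaired`). -/
theorem stub_windowReduction :
    Summit.QuantumFields.YangMills.Theses.OneCertifiedCube.FiniteSizeCriterion → ∀ (G : Type) [Group G] [TopologicalSpace G] [IsTopologicalGroup G] [CompactSpace G] [MeasurableSpace G] [BorelSpace G] (r : LatticeRep G) (a : ℝ → ℝ), (∀ β, 0 < a β) → Filter.Tendsto a Filter.atTop (nhds 0) → (∃ (Θ₀ : ℝ) (n : ℕ) (ε β₁ : ℝ), 0 < Θ₀ ∧ (1 ≤ n ∧ 0 ≤ ε ∧ ε * ((((4 * n + 3) ^ 4 - (4 * n + 1) ^ 4 : ℕ)) : ℝ) < 1) ∧ ∀ β : ℝ, β₁ ≤ β → ∀ b :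 ℕ, Θ₀ / a β ≤ (b : ℝ) → ∀ w : Fin 4 → ℤ → ℤ, (∀ i j, w i j + ((b : ℕ) : ℤ) ≤ w i (j + 1) ∧ w i (j + 1) ≤ w i j + 2 * ((b : ℕ) : ℤ)) → ∀ Y : Finset (Fin 4 → ℤ), Y ⊆ (Fintype.piFinset fun _ : Fin 4 => Finset.Icc (-(2 * ((n : ℕ) : ℤ))) (2 * ((n : ℕ) : ℤ))) → (0 : Fin 4 → ℤ) ∈ Y → ∀ η η' : LGConfig 4 G, (∀ e ∈ (Fintype.piFinset fun _ : Fin 4 => Finset.Icc (-(2 * ((n : ℕ) : ℤ))) (2 * ((n : ℕ) : ℤ))).biUnion (fun y : Fin 4 → ℤ => (Fintype.piFinset fun i : Fin 4 => Finset.Ico (w i (y i)) (w i (y i + 1))) ×ˢ (Finset.univ : Finset (Fin 4))), η e = η' e) → ∀ f : LGConfig 4 G → ℝ, IsCylinder f ((fun y : Fin 4 → ℤ => (Fintype.piFinset fun i : Fin 4 => Finset.Ico (w i (y i)) (w i (y i + 1))) ×ˢ (Finset.univ : Finset (Fin 4))) 0) → Measurable f → (∀ U, 0 ≤ f U ∧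 f U ≤ 1) → |(∫ U, f U ∂(ymSpecification r.ρ β (Y.biUnion (fun y : Fin 4 → ℤ => (Fintype.piFinset fun i : Fin 4 => Finset.Ico (w i (y i)) (w i (y i + 1))) ×ˢ (Finset.univ : Finset (Fin 4)))) η)) - ∫ U, f U ∂(ymSpecification r.ρ β (Y.biUnion (fun y : Fin 4 → ℤ => (Fintype.piFinset fun i : Fin 4 => Finset.Ico (w i (y i)) (w i (y i + 1))) ×ˢ (Finset.univ : Finset (Fin 4)))) η')| ≤ ε) → ∃ (c₁ β₂ : ℝ) (S₁ : ℝ → ℕ), 0 < c₁ ∧ ∀ A B : YMSpecies G, ∃ C : ℝ, ∀ β : ℝ, β₂ ≤ β → ∀ S n : ℕ, S₁ β ≤ S → n ≤ S → |latticeConnectedCorr r.ρ β (2 * S + 1) A.F B.F n| ≤ C * Real.exp (-(c₁ * a β * n)) := by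
  intro hF G _ _ _ _ _ _ r a hpos hlim hW
  obtain ⟨Θ, n, ε, β₁, hΘ, ⟨hn, hε, hεM⟩, hwin⟩ := hW
  exact reduction_concl_of_window hF r hpos hlim hΘ hn hε hεM hwin

end Summit.QuantumFields.YangMills.Theorems.LatticeGapInUVUnits.OneRuler

end
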